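import Summits.CriticalPhenomena.CardyFormulaZ2.Theses.CardyBoundaryCoulombGas
import Literature.Probability.LatticeModels.RowStatePlanar
import Literature.Probability.Percolation.LatticeSymmetry
import Literature.Probability.Percolation.PlanarDuality
import Literature.Probability.Percolation.RSW

/-!
# Pathwise row-transfer dictionary for bond percolation in a rectangle (general start)

Helper file for the line `two-cluster-rate-is-stationary-gap` of the crux
`CardyBoundaryCoulombGas.StripClusterRates` (stmt-CriticalPhenomena-13878), stub D1
(`stub_oneClusterDictionary`); reused by stub D3.

We drive the connectivity-state chain of `PercolationRowTransfer.lean` (`rowStep O H`) with the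
bonds of a FIXED bond configuration `ω` of `ℤ²`, read column by column in the crux rectangle
`rectangle m n = [0,m]×[0,n]`: chain time is the `x`-coordinate, the chain sites are one column
`S = Finset.Icc (0:ℤ) n`, the "vertical" bonds of the chain step `t → t+1` are the horizontal
lattice edges `{(t,y),(t+1,y)}` (the set `O t`), its "horizontal" bonds are the vertical lattice
edges `{(t+1,y),(t+1,y+1)}` of column `t+1` (the set `H t`).

* `d1_foldl_rowStep_rel_iff` — THE DICTIONARY, general in the start state: if `π₀` describes
  `ω`-connectivity inside column `0`, the symbol `⋆` being read as a fixed lattice point `q` with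
  `q 0 ≤ 0` (a point of column `0` for the wired start; a point outside every rectangle for the
  `⋆`-detached starts of stub D3), then the `m`-th iterate `X_m` describes `ω`-connectivity
  inside `rectangle m n`:
  `X_m.rel a b ↔ a = b ∨ ω ∈ openConnIn (rectangle m n) (ψ_m a) (ψ_m b)`,
  `ψ_m (inl y) = (m, y)`, `ψ_m ⋆ = q`.
  Proof: induction on `m`. `⊆`: the generators of `rowStep` (`vertRel`, `hEdgeRel`) are realised
  by open edges. `⊇`: follow an open lattice walk inside `rectangle (m+1) n` and show that the set
  of lattice points "already joined to `a`" is closed under open edges (the decomposition of the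
  walk at its visits to column `m+1`).
* small coordinate helpers `d1_vec_mem_rectangle`, `d1_mem_coe_rectangle` (points of `ℤ²` are
  compared through `Site.eq_iff_two` of `PlanarDuality.lean`), the word-peeling lemma `d1_foldl_ofFn_succ` (time `0` first, peel the
  LAST letter) and the two generator lemmas `d1_rowStep_rel_of_isUp`, `d1_rowStep_rel_of_mem`.

The wired specialisation (`ω⁺ = ω ∪` column-`0` vertical edges, `⋆ = (0,0)`), the identification
of the left–right crossing event and the `p = 1/2` counting formula are in the companion files
`…StripClusterRatesRowDictionaryWired.lean`, `…StripClusterRatesSeqCounting.lean`.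
All statements are for lattice configurations `ω ⊆ E(ℤ²)` (true almost surely,
`ae_subset_edgeSet`). Sources: Bondesan–Jacobsen–Saleur, Nucl. Phys. B 867 (2013) §2 (connectivity
transfer matrix); Blöte–Nightingale (1982); Cardy, arXiv:math-ph/0103018 §7.1 (row-transfer
exactness); folklore.
-/

noncomputable section

namespace Summit.CriticalPhenomena.CardyFormulaZ2.Cruxes.StripClusterRates.TwoClusterRateIsStationaryGap

open Filter Topology
open scoped BigOperators Classical
open Literature.Probability.Percolation Literature.Probability.LatticeModels

/-! ## Coordinates -/

/-- Membership of an explicit point in the crux rectangle. [folklore] -/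
theorem d1_vec_mem_rectangle {m n : ℕ} {i j : ℤ} :
    (![i, j] : Site 2) ∈ (rectangle m n : Set (Site 2)) ↔ 0 ≤ i ∧ i ≤ m ∧ 0 ≤ j ∧ j ≤ n := by
  simp [mem_rectangle_iff]

/-- Membership in the crux rectangle, `Set` form. [folklore] -/
theorem d1_mem_coe_rectangle {m n : ℕ} {x : Site 2} :
    x ∈ (rectangle m n : Set (Site 2)) ↔ 0 ≤ x 0 ∧ x 0 ≤ m ∧ 0 ≤ x 1 ∧ x 1 ≤ n := by
  rw [Finset.mem_coe, mem_rectangle_iff]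

/-- Peeling the LAST letter of a word read through `List.ofFn` (time `0` first). [folklore] -/
theorem d1_foldl_ofFn_succ {α β : Type*} (f : ℕ → β) (g : α → β → α) (init : α) (t : ℕ) :
    (List.ofFn fun i : Fin (t + 1) => f i).foldl g init =
      g ((List.ofFn fun i : Fin t => f i).foldl g init) (f t) := by
  rw [List.ofFn_succ', List.concat_eq_append, List.foldl_append, List.foldl_cons, List.foldl_nil]
  simp only [Fin.val_castSucc, Fin.val_last]

/-- In a row step, two row points that are open towards the new row and joined before are joined
after. [folklore] -/
theorem d1_rowStep_rel_of_isUp {S : Finset ℤ} (O H : Finset S) (X : RowState S) {c d : RowPoint S}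
    (hc : IsUp O c) (hd : IsUp O d) (hcd : X.rel c d) : (rowStep O H X).rel c d :=
  le_horizRel H (vertRel O X.rel) (Or.inr ⟨hc, hd, hcd⟩)

/-- In a row step, the two endpoints of an open horizontal bond are joined. [folklore] -/
theorem d1_rowStep_rel_of_mem {S : Finset ℤ} (O H : Finset S) (X : RowState S) {y : S}
    (h : (y : ℤ) + 1 ∈ S) (hy : y ∈ H) :
    (rowStep O H X).rel (Sum.inl y) (Sum.inl ⟨(y : ℤ) + 1, h⟩) := by
  have h1 : hEdgeRel y ≤ horizRel H (vertRel O X.rel) :=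
    le_trans (Finset.le_sup (f := hEdgeRel) hy) le_sup_right
  exact h1 (hEdgeRel_rel y h)

/-! ## The dictionary (general start) -/

/-- **Pathwise row-transfer dictionary (general start).** Fix a lattice configuration `ω ⊆ E(ℤ²)`,
read its bonds column by column (`O t` = horizontal edges `{(t,y),(t+1,y)}`, `H t` = vertical edges
`{(t+1,y),(t+1,y+1)}` of column `t+1`), and let the start state `π₀` describe `ω`-connectivity inside
column `0`, the symbol `⋆` being read as the fixed point `q` (`q 0 ≤ 0`). Then the `m`-th iterate of
`rowStep` describes `ω`-connectivity inside `rectangle m n`, `⋆` still read as `q`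
(Bondesan–Jacobsen–Saleur 2013 §2; Cardy 2001 §7.1, "row-transfer exactness"). [folklore] -/
theorem d1_foldl_rowStep_rel_iff :
    ∀ (n : ℕ) (ω : BondConfig (Site 2)), ω ⊆ (zdGraph 2).edgeSet →
    ∀ (O H : ℕ → Finset (Finset.Icc (0 : ℤ) n)),
    (∀ (t : ℕ) (y : Finset.Icc (0 : ℤ) n),
      y ∈ O t ↔ s(![(t : ℤ), (y : ℤ)], ![(t : ℤ) + 1, (y : ℤ)]) ∈ ω) →
    (∀ (t : ℕ) (y : Finset.Icc (0 : ℤ) n), (y : ℤ) + 1 ∈ Finset.Icc (0 : ℤ) n →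
      (y ∈ H t ↔ s(![(t : ℤ) + 1, (y : ℤ)], ![(t : ℤ) + 1, (y : ℤ) + 1]) ∈ ω)) →
    ∀ (q : Site 2), q 0 ≤ 0 → ∀ (π₀ : RowState (Finset.Icc (0 : ℤ) n)),
    (∀ a b, π₀.rel a b ↔ a = b ∨ ω ∈ openConnIn (rectangle 0 n : Set (Site 2))
      (Sum.elim (fun y : Finset.Icc (0 : ℤ) n => ![0, (y : ℤ)]) (fun _ => q) a)
      (Sum.elim (fun y : Finset.Icc (0 : ℤ) n => ![0, (y : ℤ)]) (fun _ => q) b)) →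
    ∀ (m : ℕ) (a b : RowPoint (Finset.Icc (0 : ℤ) n)),
    (((List.ofFn fun t : Fin m => (O t, H t)).foldl (fun r OH => rowStep OH.1 OH.2 r) π₀).rel a b ↔
      a = b ∨ ω ∈ openConnIn (rectangle m n : Set (Site 2))
        (Sum.elim (fun y : Finset.Icc (0 : ℤ) n => ![(m : ℤ), (y : ℤ)]) (fun _ => q) a)
        (Sum.elim (fun y : Finset.Icc (0 : ℤ) n => ![(m : ℤ), (y : ℤ)]) (fun _ => q) b)) := by
  intro n ω hω O H hO hH q hq π₀ h0 m a b
  induction m generalizing a b with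
  | zero =>
    simp only [Nat.cast_zero]
    exact h0 a b
  | succ t ih =>
    rw [d1_foldl_ofFn_succ (fun i => (O i, H i)) (fun r OH => rowStep OH.1 OH.2 r) π₀ t]
    change (rowStep (O t) (H t) _).rel a b ↔ _
    push_cast
    set X : RowState (Finset.Icc (0 : ℤ) n) :=
      (List.ofFn fun i : Fin t => (O i, H i)).foldl (fun r OH => rowStep OH.1 OH.2 r) π₀ with hX
    have hyS : ∀ y : Finset.Icc (0 : ℤ) n, 0 ≤ (y : ℤ) ∧ (y : ℤ) ≤ n :=
      fun y => Finset.mem_Icc.1 y.2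
    -- coordinates (`Site.eq_iff_two`)
    have vec_eq : ∀ {i j i' j' : ℤ}, (![i, j] : Site 2) = ![i', j'] ↔ i = i' ∧ j = j' :=
      fun {i j i' j'} => by rw [Site.eq_iff_two]; simp
    have eq_vec : ∀ {x : Site 2} {i j : ℤ}, x 0 = i → x 1 = j → x = ![i, j] :=
      fun {x i j} h0 h1 => by rw [Site.eq_iff_two]; simp [h0, h1]
    -- the points of columns `t + 1` and `t` attached to the row points (`⋆ ↦ q`)
    set ψ' : RowPoint (Finset.Icc (0 : ℤ) n) → Site 2 :=
      Sum.elim (fun y : Finset.Icc (0 : ℤ) n => ![(t : ℤ) + 1, (y : ℤ)]) (fun _ => q) with hψ'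
    set ψ : RowPoint (Finset.Icc (0 : ℤ) n) → Site 2 :=
      Sum.elim (fun y : Finset.Icc (0 : ℤ) n => ![(t : ℤ), (y : ℤ)]) (fun _ => q) with hψ
    set T : Setoid (RowPoint (Finset.Icc (0 : ℤ) n)) := (rowStep (O t) (H t) X).rel with hT
    have hrect : (rectangle t n : Set (Site 2)) ⊆ (rectangle (t + 1) n : Set (Site 2)) :=
      Finset.coe_subset.2 (rectangle_mono (Nat.le_succ t) le_rfl)
    -- basic facts about `T`
    have T_up : ∀ {c d : RowPoint (Finset.Icc (0 : ℤ) n)},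
        IsUp (O t) c → IsUp (O t) d → X.rel c d → T c d :=
      fun hc hd hcd => d1_rowStep_rel_of_isUp (O t) (H t) X hc hd hcd
    have T_edge : ∀ {y : Finset.Icc (0 : ℤ) n} (h : (y : ℤ) + 1 ∈ Finset.Icc (0 : ℤ) n),
        y ∈ H t → T (Sum.inl y) (Sum.inl ⟨(y : ℤ) + 1, h⟩) :=
      fun h hy => d1_rowStep_rel_of_mem (O t) (H t) X h hy
    -- memberships
    have memψ' : ∀ y : Finset.Icc (0 : ℤ) n,
        ψ' (Sum.inl y) ∈ (rectangle (t + 1) n : Set (Site 2)) := by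
      intro y
      have := hyS y
      simp only [hψ', Sum.elim_inl, d1_vec_mem_rectangle]
      omega
    have memψ : ∀ y : Finset.Icc (0 : ℤ) n, ψ (Sum.inl y) ∈ (rectangle t n : Set (Site 2)) := by
      intro y
      have := hyS y
      simp only [hψ, Sum.elim_inl, d1_vec_mem_rectangle]
      omega
    -- an open site links its two avatars in columns `t` and `t + 1`
    have link : ∀ c : RowPoint (Finset.Icc (0 : ℤ) n), IsUp (O t) c →
        ψ c ∈ (rectangle (t + 1) n : Set (Site 2)) →
        ω ∈ openConnIn (rectangle (t + 1) n : Set (Site 2)) (ψ' c) (ψ c) := by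
      rintro (y | u) hc hmem
      · have hy : y ∈ O t := hc
        refine openConnIn_of_adj (memψ' y) hmem ?_ ?_
        · simp only [hψ', hψ, Sum.elim_inl]
          rw [Sym2.eq_swap]
          exact (hO t y).1 hy
        · simp only [hψ', hψ, Sum.elim_inl, Ne, vec_eq]
          omega
      · exact openConnIn_refl hmem
    -- the target relation as a setoid
    let R : Setoid (RowPoint (Finset.Icc (0 : ℤ) n)) :=
      { r := fun c d => c = d ∨ ω ∈ openConnIn (rectangle (t + 1) n : Set (Site 2)) (ψ' c) (ψ' d)
        iseqv :=
          { refl := fun c => Or.inl rfl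
            symm := fun {c d} h => h.elim (fun h => Or.inl h.symm) fun h =>
              Or.inr (by rw [openConnIn_comm]; exact h)
            trans := fun {c d e} h₁ h₂ => by
              rcases h₁ with rfl | h₁
              · exact h₂
              rcases h₂ with rfl | h₂
              · exact Or.inr h₁
              exact Or.inr (PlanarDuality.openConnIn_trans h₁ h₂) } }
    suffices hTR : T = R by rw [hTR]; exact Iff.rfl
    apply le_antisymm
    · -- `T ≤ R`: the generators of the row step are realised by open edges
      rw [hT]
      show horizRel (H t) (vertRel (O t) X.rel) ≤ R
      refine sup_le ?_ (Finset.sup_le fun y hy => ?_)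
      · intro c d hcd
        rcases hcd with rfl | ⟨hc, hd, hcd⟩
        · exact Or.inl rfl
        rcases (ih c d).1 hcd with rfl | hconn
        · exact Or.inl rfl
        right
        have hconn' : ω ∈ openConnIn (rectangle (t + 1) n : Set (Site 2)) (ψ c) (ψ d) :=
          openConnIn_mono hrect _ _ hconn
        obtain ⟨hcmem, hdmem, -⟩ := id hconn'
        have h1 := link c hc hcmem
        have h2 := link d hd hdmem
        rw [openConnIn_comm] at h2
        exact PlanarDuality.openConnIn_trans h1 (PlanarDuality.openConnIn_trans hconn' h2)
      · by_cases h1 : (y : ℤ) + 1 ∈ Finset.Icc (0 : ℤ) n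
        · rw [hEdgeRel_of_mem y h1, joinTwo_le_iff]
          show R (Sum.inl y) (Sum.inl ⟨(y : ℤ) + 1, h1⟩)
          right
          refine openConnIn_of_adj (memψ' y) (memψ' _) ?_ ?_
          · simp only [hψ', Sum.elim_inl]
            exact (hH t y h1).1 hy
          · simp only [hψ', Sum.elim_inl, Ne, vec_eq]
            omega
        · rw [hEdgeRel_of_not_mem y h1]
          exact bot_le
    · -- `R ≤ T`: follow an open lattice walk inside `rectangle (t+1) n`
      intro c d hcd
      rcases hcd with rfl | hconn
      · exact T.refl' c
      obtain ⟨P, hPs, hPe⟩ := exists_walk_of_mem_openConnIn hω hconn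
      -- the set of lattice points already known to be joined to `c`
      let Ca : Site 2 → Prop := fun v =>
        (∃ y : Finset.Icc (0 : ℤ) n, v = ![(t : ℤ) + 1, (y : ℤ)] ∧ T c (Sum.inl y)) ∨
        (v 0 ≤ t ∧ ∃ e : RowPoint (Finset.Icc (0 : ℤ) n), T c e ∧ IsUp (O t) e ∧
          (v = ψ e ∨ ω ∈ openConnIn (rectangle t n : Set (Site 2)) (ψ e) v))
      -- from the second clause, an honest connection inside `rectangle t n`
      have conn_of : ∀ {e : RowPoint (Finset.Icc (0 : ℤ) n)} {v : Site 2},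
          v ∈ (rectangle t n : Set (Site 2)) →
          (v = ψ e ∨ ω ∈ openConnIn (rectangle t n : Set (Site 2)) (ψ e) v) →
          ω ∈ openConnIn (rectangle t n : Set (Site 2)) (ψ e) v := by
        rintro e v hv (rfl | h)
        · exact openConnIn_refl hv
        · exact h
      -- `Ca` is closed under open lattice edges inside `rectangle (t+1) n`
      have closure : ∀ v w : Site 2, (zdGraph 2).Adj v w → s(v, w) ∈ ω →
          v ∈ (rectangle (t + 1) n : Set (Site 2)) → w ∈ (rectangle (t + 1) n : Set (Site 2)) →
          Ca v → Ca w := by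
        intro v w hadj hvw hv hw hCv
        rw [d1_mem_coe_rectangle] at hv hw
        push_cast at hv hw
        have hadj' := (zdGraph_two_adj_iff v w).1 hadj
        by_cases hw0 : w 0 = (t : ℤ) + 1
        · -- `w` lies in column `t + 1`
          obtain ⟨yw, hyw⟩ : ∃ yw : Finset.Icc (0 : ℤ) n, (yw : ℤ) = w 1 :=
            ⟨⟨w 1, Finset.mem_Icc.2 ⟨hw.2.2.1, hw.2.2.2⟩⟩, rfl⟩
          have hweq : w = ![(t : ℤ) + 1, (yw : ℤ)] := eq_vec hw0 hyw.symm
          refine Or.inl ⟨yw, hweq, ?_⟩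
          rcases hCv with ⟨y, rfl, hTy⟩ | ⟨hv0, e, hTe, hUe, hev⟩
          · -- a vertical step inside column `t + 1`
            simp only [Matrix.cons_val_zero, Matrix.cons_val_one, Matrix.cons_val_fin_one] at hadj'
            rcases hadj' with ⟨h0', -⟩ | ⟨h0', -⟩ | ⟨h1', -⟩ | ⟨h1', -⟩
            · omega
            · omega
            · -- up: `w 1 = y + 1`
              have hmem : (y : ℤ) + 1 ∈ Finset.Icc (0 : ℤ) n := by
                rw [Finset.mem_Icc]; have := hyS yw; omega
              have hyw' : yw = ⟨(y : ℤ) + 1, hmem⟩ := Subtype.ext (by simp; omega)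
              rw [hyw']
              refine T.trans' hTy (T_edge hmem ((hH t y hmem).2 ?_))
              have hpt : (![(t : ℤ) + 1, (yw : ℤ)] : Site 2) = ![(t : ℤ) + 1, (y : ℤ) + 1] := by
                rw [vec_eq]; omega
              rw [hweq, hpt] at hvw
              exact hvw
            · -- down: `w 1 = y - 1`
              have hmem : (yw : ℤ) + 1 ∈ Finset.Icc (0 : ℤ) n := by
                rw [Finset.mem_Icc]; have := hyS y; omega
              have hy' : y = ⟨(yw : ℤ) + 1, hmem⟩ := Subtype.ext (by simp; omega)
              refine T.trans' hTy (T.symm' ?_)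
              rw [hy']
              refine T_edge hmem ((hH t yw hmem).2 ?_)
              have hpt : (![(t : ℤ) + 1, (y : ℤ)] : Site 2) = ![(t : ℤ) + 1, (yw : ℤ) + 1] := by
                rw [vec_eq]; omega
              rw [hweq, Sym2.eq_swap, hpt] at hvw
              exact hvw
          · -- a step from column `t` into column `t + 1`: `v = (t, yw)`, `yw ∈ O t`
            rcases hadj' with ⟨h0', h1'⟩ | ⟨h0', -⟩ | ⟨-, h0'⟩ | ⟨-, h0'⟩
            · have hveq : v = ψ (Sum.inl yw) := by
                simp only [hψ, Sum.elim_inl]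
                exact eq_vec (by omega) (by omega)
              have hvmem : v ∈ (rectangle t n : Set (Site 2)) := by
                rw [d1_mem_coe_rectangle]; omega
              have hyO : yw ∈ O t := by
                rw [hO t yw]
                rw [hveq, hweq] at hvw
                simpa only [hψ, Sum.elim_inl] using hvw
              have hXe : X.rel e (Sum.inl yw) := by
                rw [ih]
                right
                rw [← hveq]
                exact conn_of hvmem hev
              exact T.trans' hTe (T_up hUe hyO hXe)
            · omega
            · omega
            · omega
        · -- `w` lies in `rectangle t n`
          have hw0' : w 0 ≤ t := by omega
          have hwmem : w ∈ (rectangle t n : Set (Site 2)) := by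
            rw [d1_mem_coe_rectangle]; omega
          refine Or.inr ⟨hw0', ?_⟩
          rcases hCv with ⟨y, rfl, hTy⟩ | ⟨hv0, e, hTe, hUe, hev⟩
          · -- a step from column `t + 1` back into column `t`: `w = (t, y)`, `y ∈ O t`
            simp only [Matrix.cons_val_zero, Matrix.cons_val_one, Matrix.cons_val_fin_one] at hadj'
            rcases hadj' with ⟨h0', -⟩ | ⟨h0', h1'⟩ | ⟨-, h0'⟩ | ⟨-, h0'⟩
            · omega
            · have hweq : w = ψ (Sum.inl y) := by
                simp only [hψ, Sum.elim_inl]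
                exact eq_vec (by omega) (by omega)
              have hyO : y ∈ O t := by
                rw [hO t y]
                rw [hweq, Sym2.eq_swap] at hvw
                simpa only [hψ, Sum.elim_inl] using hvw
              exact ⟨Sum.inl y, hTy, hyO, Or.inl hweq⟩
            · omega
            · omega
          · -- a step inside `rectangle t n`
            have hvmem : v ∈ (rectangle t n : Set (Site 2)) := by
              rw [d1_mem_coe_rectangle]; omega
            refine ⟨e, hTe, hUe, Or.inr ?_⟩
            exact PlanarDuality.openConnIn_trans (conn_of hvmem hev)
              (openConnIn_of_adj hvmem hwmem hvw hadj.ne)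
      -- propagate `Ca` along the walk
      have walk : ∀ {u v : Site 2} (W : (zdGraph 2).Walk u v),
          (∀ z ∈ W.support, z ∈ (rectangle (t + 1) n : Set (Site 2))) →
          (∀ e ∈ W.edges, e ∈ ω) → Ca u → Ca v := by
        intro u v W
        induction W with
        | nil => intro _ _ h; exact h
        | @cons u w v hadj W ih' =>
          intro hs he hu
          refine ih' (fun z hz => hs z (by simp [hz])) (fun e he' => he e (by simp [he'])) ?_
          exact closure u w hadj (he _ (by simp)) (hs u (by simp)) (hs w (by simp)) hu
      have hstart : Ca (ψ' c) := by
        rcases c with y | u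
        · exact Or.inl ⟨y, rfl, T.refl' _⟩
        · refine Or.inr ⟨?_, Sum.inr u, T.refl' _, trivial, Or.inl rfl⟩
          show q 0 ≤ t
          omega
      have hend := walk P hPs hPe hstart
      -- read off `T c d` from `Ca (ψ' d)`
      rcases d with y | u
      · rcases hend with ⟨y', hy', hT'⟩ | ⟨h0', -⟩
        · have : y' = y := by
            simp only [hψ', Sum.elim_inl, vec_eq] at hy'
            exact Subtype.ext hy'.2.symm
          rw [← this]; exact hT'
        · exfalso
          simp only [hψ', Sum.elim_inl, Matrix.cons_val_zero] at h0'
          omega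
      · rcases hend with ⟨y', hy', -⟩ | ⟨-, e, hTe, hUe, hev⟩
        · exfalso
          have := congr_fun hy' 0
          simp only [hψ', Sum.elim_inr, Matrix.cons_val_zero] at this
          omega
        · refine T.trans' hTe ?_
          rcases e with ye | ue
          · refine T_up hUe trivial ?_
            rw [ih]
            right
            rcases hev with h | h
            · have hq' : ψ (Sum.inr u) = ψ (Sum.inl ye) := h
              rw [hq']
              exact openConnIn_refl (memψ ye)
            · exact h
          · cases u; cases ue; exact T.refl' _

end Summit.CriticalPhenomena.CardyFormulaZ2.Cruxes.StripClusterRates.TwoClusterRateIsStationaryGap
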